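import Literature.NumberTheory.LFunctions.SchoenfeldEq620Sieve

/-!
# Schoenfeld (6.20) on `[3169, 5·10⁷]` — block 06: `[30000000, 35000000)`

Topic: `Literature/NumberTheory/LFunctions`. COMPUTATIONAL (one `native_decide`): the cell loop of
`SchoenfeldEq620Sieve.lean` (certified check of `0 < {li(x) − π(x)} log x/√x < 2.523`, Schoenfeld 1976,
(6.20)) passes on `[30000000, 35000000)`, entering with `π(30000000 − 1) = 1857859` and leaving with
`π(35000000 − 1) = 2146775`. Consumed by `SchoenfeldExplicitProofs.lean` through
`SchoenfeldSieve.segOK620_step`.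

## References

* L. Schoenfeld, Math. Comp. 30 (1976), 337–360, proof of Cor. 1, (6.20) (p. 340). [Schoenfeld1976]
-/

namespace Literature.NumberTheory.LFunctions

namespace SchoenfeldSieve

/-- Block 06 of the certified check of (6.20): `checkSeg620 30000000 35000000 1857859 2146775`. [folklore] -/
theorem checkSeg620_06 : checkSeg620 30000000 35000000 1857859 2146775 = true := by
  native_decide

end SchoenfeldSieve

end Literature.NumberTheory.LFunctions
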